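import Mathlib
import HarnessLib
import Summits.Ventures.LatticeQCDFlow.Exactness.U1Omf2MultiStepErgodic
import Summits.Ventures.LatticeQCDFlow.Exactness.U1FTHMCErgodic
import Summits.Ventures.LatticeQCDFlow.Exactness.U1WilsonFlowLOMemberErgodic

/-!
# Multi-step OMF2 field-transformed HMC on `U(1)` lattice gauge fields is uniformly ergodic for short trajectories; the engine's LO Wilson-flow member is an instance

HONEST FRAMING: exact (Metropolis-corrected) sampling algorithms for lattice gauge theory;
figures of merit are autocorrelation/cost numbers at stated couplings and volumes; no
continuum-physics claim.

Venture `LatticeQCDFlow` (cell pub-lqcd), topic `Exactness`, FANOUT row 14 (`eng-flowhmc`, engine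
`latflow.fthmc`, family B: FT-HMC = HMC for the pulled-back action `S∘F − log J` REPORTED through
the member `F`, integrator `omf2` at any `n_md`, `U(1)` rung — member `maps.u1_wilson_flow_lo`).
NEW WORK of the cell over this row's `U1Omf2MultiStepErgodic.lean` (`n`-step OMF2 on `U(1)^ι`:
involution, Liouville, near-free-flight readings under `64·L·c·n² ≤ 1`), `U1WordDoeblin.lean`
(`u1Word_minorised`), GEN-9's `U1FTHMCErgodic.lean` (`abs_pulledBackAction_le`),
`U1WilsonFlowLOMemberErgodic.lean` (the LO member's layers are pinched) and row 7's
`conjKernel_minorised` / `thmc_config_exact`; nothing is cited as a fact; no number.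

* §1 `u1Omf2FTHMC_pow_invariant`, `u1Omf2FTHMC_pow_invariant_gibbsLaw` — the REPORTED `n`-step OMF2
  kernel for `S∘F − log J`, read through `F`, leaves `e^(−S)·Haar^(⊗ι)` and `π_S` invariant for
  every measurable equivalence `F` with `HasJacobian Haar^(⊗ι) F J`, `J > 0` measurable, EVERY `n`,
  every `c` (exactness); **`u1Omf2FTHMC_pow_uniformlyErgodic`**,
  **`u1Omf2FTHMC_pow_invariant_unique`** — if moreover `0 < j₁ ≤ J ≤ j₂`, `|S| ≤ s`, kicks
  `‖g₁‖, ‖g₂‖ ≤ b` both `L`-Lipschitz, `c > 0`, `κ > 0`, `n ≥ 1` and `64·L·c·n² ≤ 1`: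
  `|μ₀ K̃ᵗ(A) − π_S(A)| ≤ (1 − δ)ᵗ` for some `δ ∈ (0, 1]`, every initial law, and `π_S` is the
  unique invariant probability law;
* §2 **`u1WilsonFlowLO_member_omf2_fthmc_uniformlyErgodic`** / **`_invariant_unique`** — the
  engine's whole `U(1)` LO Wilson-flow member, ANY schedule (proper colouring, `2(d−1)|ε| < 1`,
  layers VERBATIM as in `exists_layers_u1WilsonFlowLO`): multi-step OMF2 FT-HMC through it is
  uniformly ergodic under the same condition.

NOT CLAIMED: `c ≤ 0`, longer trajectories; the Lipschitz constant of the engine's autodiff force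
through the member (taken abstractly); `SU(2)`; OMF4; learned members; any usable `δ`; floating
point; any number.
-/

noncomputable section

namespace Summit.Ventures.LatticeQCDFlow.Exactness

open MeasureTheory ProbabilityTheory ProbabilityTheory.Kernel Set
open Literature.MathematicalPhysics.QuantumFieldTheory
open scoped ENNReal NNReal

/-! ## §1 Multi-step OMF2 FT-HMC on `U(1)^ι`: exact, and uniformly ergodic for pinched Jacobians -/

section FTHMC

variable {ι : Type*} [Fintype ι] {c κ : ℝ} {g₁ g₂ : (ι → Circle) → ι → ℝ} {b : ℝ} {L : ℝ≥0}
  {S : (ι → Circle) → ℝ} {s : ℝ} {F : (ι → Circle) ≃ᵐ (ι → Circle)} {J : (ι → Circle) → ℝ} {j₁ j₂ : ℝ}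

/-- **The reported `n`-step OMF2 `U(1)` FT-HMC kernel is exact**: `n`-step OMF2 HMC for
`S∘F − log J`, reported through `F`, leaves `e^(−S)·Haar^(⊗ι)` invariant (`thmc_config_exact`). -/
theorem u1Omf2FTHMC_pow_invariant (hκ : 0 < κ) (hg₁ : Measurable g₁) (hg₂ : Measurable g₂) (n : ℕ)
    (hJ : ∀ v, 0 < J v)
    (hJm : Measurable J)
    (hF : HasJacobian (Measure.pi fun _ : ι => haarProbability Circle) F fun v => ENNReal.ofReal (J v))
    (hS : Measurable S) :
    Invariant (conjKernel (refreshUpdate (involMH _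
        (measurable_flip_omf2Word_pow (measurable_u1ExpDrift c) hg₁ hg₂ n)
        fun z : (ι → Circle) × (ι → ℝ) => (S (F z.1) - Real.log (J z.1)) + u1Kinetic κ z.2)
        (u1MomentumLaw κ)) F)
      ((Measure.pi fun _ : ι => haarProbability Circle).withDensity
        fun u => ENNReal.ofReal (Real.exp (-S u))) :=
  thmc_config_exact (vol := Measure.pi fun _ : ι => haarProbability Circle)
    (volP := volume) (hΦ := measurable_flip_omf2Word_pow (measurable_u1ExpDrift c) hg₁ hg₂ n)
    hJ hJm hF hS (measurable_u1Kinetic κ) (involutive_u1Omf2Proposal_pow c g₁ g₂ n)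
    (measurePreserving_u1Omf2Proposal_pow c hg₁ hg₂ n)
    (u1MomentumWeight_univ_ne_zero hκ) (u1MomentumWeight_univ_ne_top hκ)

/-- … and the normalised Gibbs law `π_S` is invariant. -/
theorem u1Omf2FTHMC_pow_invariant_gibbsLaw (hκ : 0 < κ) (hg₁ : Measurable g₁) (hg₂ : Measurable g₂)
    (n : ℕ) (hJ : ∀ v, 0 < J v) (hJm : Measurable J)
    (hF : HasJacobian (Measure.pi fun _ : ι => haarProbability Circle) F fun v => ENNReal.ofReal (J v))
    (hS : Measurable S) :
    Invariant (conjKernel (refreshUpdate (involMH _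
        (measurable_flip_omf2Word_pow (measurable_u1ExpDrift c) hg₁ hg₂ n)
        fun z : (ι → Circle) × (ι → ℝ) => (S (F z.1) - Real.log (J z.1)) + u1Kinetic κ z.2)
        (u1MomentumLaw κ)) F) (u1GibbsLaw S) :=
  invariant_smul (u1Omf2FTHMC_pow_invariant hκ hg₁ hg₂ n hJ hJm hF hS) _

/-- **MULTI-STEP OMF2 FIELD-TRANSFORMED HMC ON `U(1)^ι` IS UNIFORMLY ERGODIC FOR SHORT
TRAJECTORIES**: measurable equivalence `F` with a PINCHED certified Jacobian `0 < j₁ ≤ J ≤ j₂`,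
measurable `|S| ≤ s`, kicks bounded by `b` and `L`-Lipschitz, `c > 0`, `κ > 0`, `n ≥ 1`,
`64·L·c·n² ≤ 1`. -/
theorem u1Omf2FTHMC_pow_uniformlyErgodic (hc : 0 < c) (hκ : 0 < κ) (hg₁ : Measurable g₁)
    (hg₂ : Measurable g₂) (hb₁ : ∀ v, ‖g₁ v‖ ≤ b) (hb₂ : ∀ v, ‖g₂ v‖ ≤ b)
    (hL₁ : LipschitzWith L g₁) (hL₂ : LipschitzWith L g₂) {n : ℕ} (hn0 : 0 < n)
    (hn : 64 * (L : ℝ) * c * (n : ℝ) ^ 2 ≤ 1) (hS : Measurable S) (hs : ∀ u, |S u| ≤ s)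
    (hj₁ : 0 < j₁) (hJ₁ : ∀ v, j₁ ≤ J v) (hJ₂ : ∀ v, J v ≤ j₂) (hJm : Measurable J)
    (hF : HasJacobian (Measure.pi fun _ : ι => haarProbability Circle) F fun v => ENNReal.ofReal (J v)) :
    ∃ δ : ℝ, 0 < δ ∧ δ ≤ 1 ∧ ∀ (μ₀ : Measure (ι → Circle)) [IsProbabilityMeasure μ₀] (t : ℕ)
      (A : Set (ι → Circle)),
      |((fun m : Measure (ι → Circle) =>
            m.bind (conjKernel (refreshUpdate (involMH _
        (measurable_flip_omf2Word_pow (measurable_u1ExpDrift c) hg₁ hg₂ n)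
        fun z : (ι → Circle) × (ι → ℝ) => (S (F z.1) - Real.log (J z.1)) + u1Kinetic κ z.2)
        (u1MomentumLaw κ)) F))^[t]
          μ₀).real A
          - (u1GibbsLaw S).real A| ≤ (1 - δ) ^ t := by
  haveI : Fact (0 < κ) := ⟨hκ⟩
  haveI := isProbabilityMeasure_u1GibbsLaw (ι := ι) hs
  have hJ : ∀ v, 0 < J v := fun v => hj₁.trans_le (hJ₁ v)
  have hSt : Measurable fun v : ι → Circle => S (F v) - Real.log (J v) :=
    (hS.comp F.measurable).sub (Real.measurable_log.comp hJm)
  obtain ⟨hfst, hsnd⟩ := u1Omf2_pow_readings (ι := ι) hc hb₁ hb₂ hL₁ hL₂ hn0 hn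
  have hb0 : 0 ≤ b := (norm_nonneg _).trans (hb₁ fun _ => 1)
  have hnR : (0 : ℝ) < n := by exact_mod_cast hn0
  have ha : (0 : ℝ) < n * (2 * c) := by positivity
  have hlam : ((Real.toNNReal (n * |2 * c| / 3) : ℝ≥0) : ℝ) < n * (2 * c) := by
    rw [Real.coe_toNNReal _ (by positivity), abs_of_pos (by positivity : (0 : ℝ) < 2 * c)]
    nlinarith
  obtain ⟨δ, hδ0, hmin⟩ := u1Word_minorised
    (measurable_flip_omf2Word_pow (measurable_u1ExpDrift c) hg₁ hg₂ n) hκ ha hlam (by positivity)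
    hfst hsnd hSt (abs_pulledBackAction_le hs hj₁ hJ₁ hJ₂)
  have hmin' := fun x => conjKernel_minorised hmin F x
  have hH : Measurable fun z : (ι → Circle) × (ι → ℝ) =>
      (S (F z.1) - Real.log (J z.1)) + u1Kinetic κ z.2 :=
    (hSt.comp measurable_fst).add ((measurable_u1Kinetic κ).comp measurable_snd)
  haveI : Fact (Measurable fun z : (ι → Circle) × (ι → ℝ) =>
      (S (F z.1) - Real.log (J z.1)) + u1Kinetic κ z.2) := ⟨hH⟩
  haveI : IsMarkovKernel (refreshUpdate (involMH _
        (measurable_flip_omf2Word_pow (measurable_u1ExpDrift c) hg₁ hg₂ n)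
        fun z : (ι → Circle) × (ι → ℝ) => (S (F z.1) - Real.log (J z.1)) + u1Kinetic κ z.2)
        (u1MomentumLaw κ)) := by
    infer_instance
  haveI : IsProbabilityMeasure ((Measure.pi fun _ : ι => haarProbability Circle).map F) :=
    Measure.isProbabilityMeasure_map F.measurable.aemeasurable
  have hδ1 : δ ≤ 1 := by
    have h := Measure.le_iff'.1 (hmin fun _ => 1) univ
    rwa [Measure.smul_apply, smul_eq_mul, measure_univ, measure_univ, mul_one] at h
  have hδtop : δ ≠ ⊤ := ne_top_of_le_ne_top ENNReal.one_ne_top hδ1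
  refine ⟨δ.toReal, ENNReal.toReal_pos hδ0.ne' hδtop,
    ENNReal.toReal_le_of_le_ofReal zero_le_one (by rwa [ENNReal.ofReal_one]), fun μ₀ _ t A => ?_⟩
  exact uniformlyErgodic_of_minorised hmin'
    (u1Omf2FTHMC_pow_invariant_gibbsLaw hκ hg₁ hg₂ n hJ hJm hF hS) μ₀ t A

/-- **The Gibbs law is the unique invariant probability law of the reported `n`-step OMF2 `U(1)`
FT-HMC kernel** (same hypotheses). -/
theorem u1Omf2FTHMC_pow_invariant_unique (hc : 0 < c) (hκ : 0 < κ) (hg₁ : Measurable g₁)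
    (hg₂ : Measurable g₂) (hb₁ : ∀ v, ‖g₁ v‖ ≤ b) (hb₂ : ∀ v, ‖g₂ v‖ ≤ b)
    (hL₁ : LipschitzWith L g₁) (hL₂ : LipschitzWith L g₂) {n : ℕ} (hn0 : 0 < n)
    (hn : 64 * (L : ℝ) * c * (n : ℝ) ^ 2 ≤ 1) (hS : Measurable S) (hs : ∀ u, |S u| ≤ s)
    (hj₁ : 0 < j₁) (hJ₁ : ∀ v, j₁ ≤ J v) (hJ₂ : ∀ v, J v ≤ j₂) (hJm : Measurable J)
    (hF : HasJacobian (Measure.pi fun _ : ι => haarProbability Circle) F fun v => ENNReal.ofReal (J v))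
    {π' : Measure (ι → Circle)} [IsProbabilityMeasure π']
    (hπ' : Invariant (conjKernel (refreshUpdate (involMH _
        (measurable_flip_omf2Word_pow (measurable_u1ExpDrift c) hg₁ hg₂ n)
        fun z : (ι → Circle) × (ι → ℝ) => (S (F z.1) - Real.log (J z.1)) + u1Kinetic κ z.2)
        (u1MomentumLaw κ)) F) π') :
    π' = u1GibbsLaw S := by
  haveI : Fact (0 < κ) := ⟨hκ⟩
  haveI := isProbabilityMeasure_u1GibbsLaw (ι := ι) hs
  have hJ : ∀ v, 0 < J v := fun v => hj₁.trans_le (hJ₁ v)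
  have hSt : Measurable fun v : ι → Circle => S (F v) - Real.log (J v) :=
    (hS.comp F.measurable).sub (Real.measurable_log.comp hJm)
  obtain ⟨hfst, hsnd⟩ := u1Omf2_pow_readings (ι := ι) hc hb₁ hb₂ hL₁ hL₂ hn0 hn
  have hb0 : 0 ≤ b := (norm_nonneg _).trans (hb₁ fun _ => 1)
  have hnR : (0 : ℝ) < n := by exact_mod_cast hn0
  have ha : (0 : ℝ) < n * (2 * c) := by positivity
  have hlam : ((Real.toNNReal (n * |2 * c| / 3) : ℝ≥0) : ℝ) < n * (2 * c) := by
    rw [Real.coe_toNNReal _ (by positivity), abs_of_pos (by positivity : (0 : ℝ) < 2 * c)]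
    nlinarith
  obtain ⟨δ, hδ0, hmin⟩ := u1Word_minorised
    (measurable_flip_omf2Word_pow (measurable_u1ExpDrift c) hg₁ hg₂ n) hκ ha hlam (by positivity)
    hfst hsnd hSt (abs_pulledBackAction_le hs hj₁ hJ₁ hJ₂)
  have hmin' := fun x => conjKernel_minorised hmin F x
  haveI : Fact (Measurable fun z : (ι → Circle) × (ι → ℝ) =>
      (S (F z.1) - Real.log (J z.1)) + u1Kinetic κ z.2) :=
    ⟨(hSt.comp measurable_fst).add ((measurable_u1Kinetic κ).comp measurable_snd)⟩
  haveI : IsMarkovKernel (refreshUpdate (involMH _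
        (measurable_flip_omf2Word_pow (measurable_u1ExpDrift c) hg₁ hg₂ n)
        fun z : (ι → Circle) × (ι → ℝ) => (S (F z.1) - Real.log (J z.1)) + u1Kinetic κ z.2)
        (u1MomentumLaw κ)) := by
    infer_instance
  haveI : IsProbabilityMeasure ((Measure.pi fun _ : ι => haarProbability Circle).map F) :=
    Measure.isProbabilityMeasure_map F.measurable.aemeasurable
  exact invariant_unique_of_minorised hmin' hδ0
    (u1Omf2FTHMC_pow_invariant_gibbsLaw hκ hg₁ hg₂ n hJ hJm hF hS) hπ'

end FTHMC

/-! ## §2 The engine's `U(1)` LO Wilson-flow member (any schedule): multi-step OMF2 FT-HMC through it -/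

section U1LO

variable {d L : ℕ} {X : Type*} [DecidableEq X] (χ : Site d L → X) [NeZero L]

/-- **MULTI-STEP OMF2 FT-HMC through the engine's whole `U(1)` LO Wilson-flow member — ANY
schedule — is uniformly ergodic for short trajectories.**  Proper colouring `χ`, `2(d−1)|ε| < 1`,
layers packaged VERBATIM as in `exists_layers_u1WilsonFlowLO`; any measurable `|S| ≤ s'`; kicks
bounded by `b'`, `Lg`-Lipschitz, half-drift `c > 0`, `κ' > 0`, `n ≥ 1`, `64·Lg·c·n² ≤ 1`. -/
theorem u1WilsonFlowLO_member_omf2_fthmc_uniformlyErgodic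
    (hχ : ∀ (x : Site d L) (i : Fin d), χ (x.shift i) ≠ χ x) {ε : ℝ}
    (hε : |ε| * (2 * ((d - 1 : ℕ) : ℝ)) < 1) (sched : List (Fin d × X))
    {c κ' : ℝ} (hc : 0 < c) (hκ' : 0 < κ')
    {g₁ g₂ : GaugeConfig d L Circle → Edge d L → ℝ} (hg₁ : Measurable g₁) (hg₂ : Measurable g₂)
    {b' : ℝ} (hb₁ : ∀ v, ‖g₁ v‖ ≤ b') (hb₂ : ∀ v, ‖g₂ v‖ ≤ b') {Lg : ℝ≥0}
    (hL₁ : LipschitzWith Lg g₁) (hL₂ : LipschitzWith Lg g₂) {n : ℕ} (hn0 : 0 < n)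
    (hn : 64 * (Lg : ℝ) * c * (n : ℝ) ^ 2 ≤ 1)
    {S : GaugeConfig d L Circle → ℝ} (hS : Measurable S) {s' : ℝ} (hs : ∀ u, |S u| ≤ s') :
    ∃ layers : List ((GaugeConfig d L Circle ≃ᵐ GaugeConfig d L Circle) × (GaugeConfig d L Circle → ℝ)),
      layers.map (fun Ly => ((Ly.1 : GaugeConfig d L Circle → GaugeConfig d L Circle), Ly.2)) = sched.map (fun s =>
        ((fun (V : GaugeConfig d L Circle) (e : Edge d L) => if e.2 = s.1 ∧ χ e.1 = s.2 then
          V e * Circle.exp (ε * ∑ ν ∈ Finset.univ.erase e.2,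
            (((plaquetteHolonomy V (e.1 - Pi.single ν 1) e.2 ν : Circle) : ℂ).im -
              ((plaquetteHolonomy V e.1 e.2 ν : Circle) : ℂ).im)) else V e),
         fun V : GaugeConfig d L Circle => ∏ a : {e : Edge d L // e.2 = s.1 ∧ χ e.1 = s.2},
          (1 - ε * ∑ ν ∈ Finset.univ.erase a.1.2,
            (((plaquetteHolonomy V a.1.1 a.1.2 ν : Circle) : ℂ).re +
              ((plaquetteHolonomy V (a.1.1 - Pi.single ν 1) a.1.2 ν : Circle) : ℂ).re)))) ∧
      ∃ δ : ℝ, 0 < δ ∧ δ ≤ 1 ∧ ∀ (μ₀ : Measure (GaugeConfig d L Circle)) [IsProbabilityMeasure μ₀]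
        (t : ℕ) (A : Set (GaugeConfig d L Circle)),
        |((fun m : Measure (GaugeConfig d L Circle) =>
              m.bind (conjKernel (refreshUpdate (involMH _
                  (measurable_flip_omf2Word_pow (measurable_u1ExpDrift c) hg₁ hg₂ n)
                  fun z : GaugeConfig d L Circle × (Edge d L → ℝ) =>
                    (S ((layers.foldr (fun Ly (F : GaugeConfig d L Circle ≃ᵐ GaugeConfig d L Circle) =>
                        Ly.1.trans F) (MeasurableEquiv.refl (GaugeConfig d L Circle))) z.1) -
                      Real.log ((layers.foldr (fun Ly K => fun v => Ly.2 v * K (Ly.1 v))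
                        (fun _ => (1 : ℝ))) z.1)) + u1Kinetic κ' z.2) (u1MomentumLaw κ'))
                (layers.foldr (fun Ly (F : GaugeConfig d L Circle ≃ᵐ GaugeConfig d L Circle) =>
                  Ly.1.trans F) (MeasurableEquiv.refl (GaugeConfig d L Circle)))))^[t] μ₀).real A
            - (u1GibbsLaw S).real A| ≤ (1 - δ) ^ t := by
  obtain ⟨layers, hmap, hpos, hmeas, hjac⟩ := exists_layers_u1WilsonFlowLO χ hχ hε sched
  refine ⟨layers, hmap, ?_⟩
  obtain ⟨-, hfmeas, hfjac⟩ := hasJacobian_foldr_trans layers hpos hmeas hjac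
  have hpinch := u1WilsonFlowLO_layers_pinched χ hε.le sched layers hmap
  have h0 : 0 < 1 - |ε| * (2 * ((d - 1 : ℕ) : ℝ)) := by linarith
  have hfold := fun v => foldr_logDet_mem_Icc layers (pow_nonneg h0.le _) hpinch v
  exact u1Omf2FTHMC_pow_uniformlyErgodic hc hκ' hg₁ hg₂ hb₁ hb₂ hL₁ hL₂ hn0 hn hS hs
    (pow_pos (pow_pos h0 _) _) (fun v => (hfold v).1) (fun v => (hfold v).2) hfmeas hfjac

/-- **… and `π_S` is the unique invariant probability law of the member's reported `n`-step
kernel** (same hypotheses). -/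
theorem u1WilsonFlowLO_member_omf2_fthmc_invariant_unique
    (hχ : ∀ (x : Site d L) (i : Fin d), χ (x.shift i) ≠ χ x) {ε : ℝ}
    (hε : |ε| * (2 * ((d - 1 : ℕ) : ℝ)) < 1) (sched : List (Fin d × X))
    {c κ' : ℝ} (hc : 0 < c) (hκ' : 0 < κ')
    {g₁ g₂ : GaugeConfig d L Circle → Edge d L → ℝ} (hg₁ : Measurable g₁) (hg₂ : Measurable g₂)
    {b' : ℝ} (hb₁ : ∀ v, ‖g₁ v‖ ≤ b') (hb₂ : ∀ v, ‖g₂ v‖ ≤ b') {Lg : ℝ≥0}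
    (hL₁ : LipschitzWith Lg g₁) (hL₂ : LipschitzWith Lg g₂) {n : ℕ} (hn0 : 0 < n)
    (hn : 64 * (Lg : ℝ) * c * (n : ℝ) ^ 2 ≤ 1)
    {S : GaugeConfig d L Circle → ℝ} (hS : Measurable S) {s' : ℝ} (hs : ∀ u, |S u| ≤ s') :
    ∃ layers : List ((GaugeConfig d L Circle ≃ᵐ GaugeConfig d L Circle) × (GaugeConfig d L Circle → ℝ)),
      layers.map (fun Ly => ((Ly.1 : GaugeConfig d L Circle → GaugeConfig d L Circle), Ly.2)) = sched.map (fun s =>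
        ((fun (V : GaugeConfig d L Circle) (e : Edge d L) => if e.2 = s.1 ∧ χ e.1 = s.2 then
          V e * Circle.exp (ε * ∑ ν ∈ Finset.univ.erase e.2,
            (((plaquetteHolonomy V (e.1 - Pi.single ν 1) e.2 ν : Circle) : ℂ).im -
              ((plaquetteHolonomy V e.1 e.2 ν : Circle) : ℂ).im)) else V e),
         fun V : GaugeConfig d L Circle => ∏ a : {e : Edge d L // e.2 = s.1 ∧ χ e.1 = s.2},
          (1 - ε * ∑ ν ∈ Finset.univ.erase a.1.2,
            (((plaquetteHolonomy V a.1.1 a.1.2 ν : Circle) : ℂ).re +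
              ((plaquetteHolonomy V (a.1.1 - Pi.single ν 1) a.1.2 ν : Circle) : ℂ).re)))) ∧
      ∀ (π' : Measure (GaugeConfig d L Circle)) [IsProbabilityMeasure π'],
        Invariant (conjKernel (refreshUpdate (involMH _
              (measurable_flip_omf2Word_pow (measurable_u1ExpDrift c) hg₁ hg₂ n)
              fun z : GaugeConfig d L Circle × (Edge d L → ℝ) =>
                (S ((layers.foldr (fun Ly (F : GaugeConfig d L Circle ≃ᵐ GaugeConfig d L Circle) =>
                    Ly.1.trans F) (MeasurableEquiv.refl (GaugeConfig d L Circle))) z.1) -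
                  Real.log ((layers.foldr (fun Ly K => fun v => Ly.2 v * K (Ly.1 v))
                    (fun _ => (1 : ℝ))) z.1)) + u1Kinetic κ' z.2) (u1MomentumLaw κ'))
            (layers.foldr (fun Ly (F : GaugeConfig d L Circle ≃ᵐ GaugeConfig d L Circle) =>
              Ly.1.trans F) (MeasurableEquiv.refl (GaugeConfig d L Circle)))) π' →
        π' = u1GibbsLaw S := by
  obtain ⟨layers, hmap, hpos, hmeas, hjac⟩ := exists_layers_u1WilsonFlowLO χ hχ hε sched
  refine ⟨layers, hmap, fun π' _ hπ' => ?_⟩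
  obtain ⟨-, hfmeas, hfjac⟩ := hasJacobian_foldr_trans layers hpos hmeas hjac
  have hpinch := u1WilsonFlowLO_layers_pinched χ hε.le sched layers hmap
  have h0 : 0 < 1 - |ε| * (2 * ((d - 1 : ℕ) : ℝ)) := by linarith
  have hfold := fun v => foldr_logDet_mem_Icc layers (pow_nonneg h0.le _) hpinch v
  exact u1Omf2FTHMC_pow_invariant_unique hc hκ' hg₁ hg₂ hb₁ hb₂ hL₁ hL₂ hn0 hn hS hs
    (pow_pos (pow_pos h0 _) _) (fun v => (hfold v).1) (fun v => (hfold v).2) hfmeas hfjac hπ'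

end U1LO

end Summit.Ventures.LatticeQCDFlow.Exactness
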